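import Summits.CriticalPhenomena.PercolationContinuityZ3.Theorems.PercNearOneGluingNoHeavyQuantGluedDeepTransfer
import Summits.CriticalPhenomena.PercolationContinuityZ3.Theorems.PercNearOneGluingNoHeavyQuantFlowAtTMonotone
import HarnessLib

/-!
# QUANT lane R8, T-DEC: LEMMA W for the glued-piece slice — the light WINDOW pairs of the single-layer route to `LawDec.GluedDominated`, typed as ONE
# explicit flow statement (`LawDec.GluedLemmaW`, `@[conjecture]`) with its use proved: given it, a light window pair below a CHEAP atom satisfies its
# pair condition with the pullback itself (arm-1 gen 58, architect)

builds on p205010 (kernel theorem, internal audit signed; external expert review pending)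

Statement + support file (`--supports stmt-CriticalPhenomena-4575`), QUANT lane seat prim-quant-arm-1 (gen 58, architect); memo
`run/shared/lean/prim/quant/prim-quant-arm-1-g58/ARCH-G58.md` §2, §4.  One `@[conjecture]`, theorems; standard axioms, no sorries.

THE RESIDUE OF THE SINGLE-LAYER ROUTE (`…QuantGluedTransfer`, `…QuantGluedDeepTransfer`): with `J = max(j − r − k, h_c)` (`h_c` the largest CHEAP atom of the
pullback `Ψ`: `−Ψ(h_c)·y/(1−y) < Ψ(l*)`, `l*` a low) every condition "Ψ is a price system of the first factor at `(y, T₀, J)`" is a theorem EXCEPT the pair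
conditions of the tight LIGHT pairs `{l, h; γ < y}` whose mid lies in the window `j − r − k < h ≤ h_c` (and the gate row for `a < 1`).  For those, census-2 g55's
device (LEMMA W / `SliceLawSW`: move some of the image's top-copy mass to the cheap atom and use weak duality there) has, for the 3-atom piece, the following
e-free form, found by LP duality (memo §4):
* **`LawDec.GluedLemmaW`** (`@[conjecture]`): in the band frame of `GluedDominated` (`y = ax`, `T₀ = aS`, `T = a(S+m)`), for every light window pair `(l, h)`,
  every position `c` with `h ≤ c ≤ min(j, B)` and every low position `l*`, SOME `τ ≥ 0` makes the measure
  `{l,h;γ} ∗ t + τ·(δ_{l*} ∗ t) + τ·y/(1−y)·(δ_c ∗ t)` flow-feasible (`FlowAtT`) at `(y, T, j)`.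
  EVIDENCE: as an LP in (flow, τ): 226 528 / 226 528 configurations feasible (incl. `a < 1`, the edges `x = qg`, `S = xB`, `g ↑ 1`) + a corner sweep (B ≤ 3,
  a ∈ {1, .5, .1, .02, .999}, q ↑ 1, g ↓ 0 / ↑ 1, x at both ends of the band: 9 877 / 9 877, exact re-check of every float failure); kit j288446/j288448 at scale,
  `--workitem 4575`), whereas the literal `SliceLawSW` analogue (`c = h`, no `l*` term) fails in 80 / 31 271 window pairs — exactly configurations in which the atom can
  never be cheap (memo §4, `wcase.py`).  By LP duality (W-glued) is EQUIVALENT, configuration by configuration, to: [price axioms ∧ `c` cheap w.r.t. `l*`] ⟹ the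
  pair condition for `(l, h)` — which holds in 1 117 / 1 117 exact LP instances (`wlp.py`).
* **`LawDec.gluedPullback_windowPair_of_lemmaW`** (THE USE, proved): `GluedLemmaW →` for every price system `(α, p)` of the positions at `(y, T, j)`, every light
  window pair `(l, h)`, every `c ∈ [h, min(j,B)]` CHEAP w.r.t. a low `l*` (`−Ψ(c)·y < (1−y)·Ψ(l*)`): `(1−γ)Ψ(l) + γΨ(h) ≤ 0`; **`…_usage`**: the pair condition
  `Ψ(l) ≤ usage y T₀ J l h·(−Ψ(h))` at every layer `J ≥ h`.  (Weak duality on the normalised measure — `FlowAtT.smul`, `decAtT_of_flowAtT`,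
  `glued_image_dual_le` — and `τ·[Ψ(l*) + y/(1−y)·Ψ(c)] > 0`.)
So, GIVEN `GluedLemmaW`, the single-layer conditions at `J(e)` hold for a = 1 completely (absorbers, giants, heavy pairs, deep pairs: theorems; light window
pairs: here); what then remains of `GluedDominated` is the assembly (choice of `J(e)`, bookkeeping) and the gate row for `a < 1` (memo §5).

HONEST STATUS.  `GluedLemmaW`, `GluedDominated`, the band, `SiblingStep`, `FarTreeRow` OPEN; RATE class (log\*) / honest sentence of
`run/shared/lean/prim/quant/README.md` unchanged.  [this work].  Nothing here is cited as a published result.  The gluing rows served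
[cite: KozmaNitzan2024, Conjecture 3 (p. 15)]; product measure [cite: Grimmett1999, §1.3 p. 10].
-/

noncomputable section

open scoped BigOperators

namespace Summit.CriticalPhenomena.PercolationContinuityZ3.Theorems
namespace Quant

open Finset

namespace LawDec

/-- the point mass `δ_K` -/
local notation3 "δ[" K "]" => (fun k : ℕ => if k = (K : ℕ) then (1 : ℝ) else 0)

/-- the two-point law `{lo, lo+K; g}` = `lo` sure relays and a blob of size `K` at gate `g` -/
local notation3 "TPL[" lo ", " K ", " g "]" => lconv lo K δ[lo] (gate δ[K] g)

/-! ### The conjecture -/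

/-- **CONJECTURE (LEMMA W for the glued-piece slice; arm-1 g58, memo ARCH-G58 §4).**  Band frame: `0 < x < 1`, `0 < a ≤ 1`, `0 < q < 1`, `0 ≤ g ≤ 1`, `r, k ≥ 1`,
`x ≤ qg`, `2r < m := q(r+kg)`, `m − r < kx`, `xB ≤ S ≤ B`, `j < B + (r+k)`; `y = ax`, `T₀ = aS`, `T = a(S+m)`; `t = gate {r,r+k;g} q`.  For every LIGHT WINDOW
pair — `l < h ≤ B`, `h ≤ j < h + r + k`, `2l < T₀ < l + h`, `γ := pairGate y T₀ l h < y` — every `c` with `h ≤ c ≤ B`, `c ≤ j`, and every `l* ≤ B`, `l* ≤ j`,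
`2l* < T₀`, there is `τ ≥ 0` such that the measure `({l,h;γ} + τ·δ_{l*} + τ·y/(1−y)·δ_c) ∗ t` on `{0..B+(r+k)}` is flow-feasible at `(y, T, j)`
(`LawDec.FlowAtT`).  EVIDENCE: file header.  USE: `gluedPullback_windowPair_of_lemmaW`. [this work] [status: open] -/
@[conjecture] def GluedLemmaW : Prop :=
  ∀ (x a q g S : ℝ) (B r k j l h c ls : ℕ),
    0 < x → x < 1 → 0 < a → a ≤ 1 → 0 < q → q < 1 → 0 ≤ g → g ≤ 1 → 1 ≤ r → 1 ≤ k →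
    x ≤ q * g → 2 * (r : ℝ) < q * ((r : ℝ) + k * g) → q * ((r : ℝ) + k * g) - r < (k : ℝ) * x →
    x * (B : ℝ) ≤ S → S ≤ (B : ℝ) → j < B + (r + k) →
    l < h → h ≤ B → h ≤ j → j < h + r + k → 2 * (l : ℝ) < a * S → a * S < (l : ℝ) + h →
    pairGate (a * x) (a * S) l h < a * x →
    h ≤ c → c ≤ B → c ≤ j → ls ≤ B → ls ≤ j → 2 * (ls : ℝ) < a * S →
    ∃ τ : ℝ, 0 ≤ τ ∧
      FlowAtT (a * x) (a * (S + q * ((r : ℝ) + k * g))) j (B + (r + k))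
        (lconv B (r + k)
          (fun i => (pairGate (a * x) (a * S) l h) * δ[h] i + (1 - pairGate (a * x) (a * S) l h) * δ[l] i
            + τ * δ[ls] i + τ * ((a * x) / (1 - a * x)) * δ[c] i)
          (gate (TPL[r, k, g]) q))

/-! ### The use: a light window pair below a cheap atom satisfies its pair condition -/

/-- the value of the pullback on the W-measure's first factor. [this work] -/
theorem sum_W_gluedPullback (B l h c ls : ℕ) (γ τ u : ℝ) (Ψ : ℕ → ℝ) (hlB : l ≤ B) (hhB : h ≤ B) (hcB : c ≤ B) (hlsB : ls ≤ B) :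
    ∑ i ∈ Finset.range (B + 1), (γ * δ[h] i + (1 - γ) * δ[l] i + τ * δ[ls] i + τ * u * δ[c] i) * Ψ i
      = (1 - γ) * Ψ l + γ * Ψ h + τ * Ψ ls + τ * u * Ψ c := by
  have e2 : ∀ i ∈ Finset.range (B + 1), (γ * δ[h] i + (1 - γ) * δ[l] i + τ * δ[ls] i + τ * u * δ[c] i) * Ψ i
      = γ * (Ψ i * (if i = h then (1 : ℝ) else 0)) + (1 - γ) * (Ψ i * (if i = l then (1 : ℝ) else 0))
        + τ * (Ψ i * (if i = ls then (1 : ℝ) else 0)) + τ * u * (Ψ i * (if i = c then (1 : ℝ) else 0)) := by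
    intro i _; beta_reduce; ring
  rw [Finset.sum_congr rfl e2, Finset.sum_add_distrib, Finset.sum_add_distrib, Finset.sum_add_distrib, ← Finset.mul_sum, ← Finset.mul_sum,
    ← Finset.mul_sum, ← Finset.mul_sum, sum_mul_indicator Ψ B h hhB, sum_mul_indicator Ψ B l hlB, sum_mul_indicator Ψ B ls hlsB,
    sum_mul_indicator Ψ B c hcB]
  ring

/-- weak duality on a measure of the form `C ∗ t` with `C` of positive mass: flow-feasibility at `(y, T, j)` gives `Σ_h C(h)·Ψ(h) ≤ 0` for every
price system (normalise by the mass — `FlowAtT.smul` — then `decAtT_of_flowAtT`, `glued_image_dual_le`). [this work] -/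
theorem glued_measure_dual_le (y q g T : ℝ) (r k j B : ℕ) (C α p : ℕ → ℝ) (hy0 : 0 < y) (hy1 : y < 1) (hq0 : 0 ≤ q) (hq1 : q ≤ 1)
    (hg0 : 0 ≤ g) (hg1 : g ≤ 1) (hr : 1 ≤ r) (hjM : j < B + (r + k))
    (hCpos : 0 < ∑ i ∈ Finset.range (B + 1), C i)
    (hF : FlowAtT y T j (B + (r + k)) (lconv B (r + k) C (gate (TPL[r, k, g]) q)))
    (hp : ∀ h, 0 ≤ p h)
    (hαp : ∀ l h, l ≤ j → 2 * (l : ℝ) < T → h ≤ B + (r + k) → (j + 1 ≤ h ∨ T < (l : ℝ) + h) → α l ≤ usage y T j l h * p h) :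
    ∑ i ∈ Finset.range (B + 1), C i * gluedPullback T q g j r k α p i ≤ 0 := by
  obtain ⟨t0, tM, t1, tmn⟩ := glued_laws q g r k hq0 hq1 hg0 hg1
  set μ : ℝ := ∑ i ∈ Finset.range (B + 1), C i with hμ
  set C' : ℕ → ℝ := fun i => μ⁻¹ * C i with hC'
  have hμi : 0 < μ⁻¹ := inv_pos.2 hCpos
  have c1 : ∑ i ∈ Finset.range (B + 1), C' i = 1 := by
    rw [hC', ← Finset.mul_sum, ← hμ, inv_mul_cancel₀ hCpos.ne']
  have e : lconv B (r + k) C' (gate (TPL[r, k, g]) q) = fun u => μ⁻¹ * lconv B (r + k) C (gate (TPL[r, k, g]) q) u :=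
    funext fun u => by
      rw [hC']
      have := lconv_lin_left B (r + k) μ⁻¹ 0 C C (gate (TPL[r, k, g]) q) u
      simp only [zero_mul, add_zero] at this
      exact this
  have hF' : FlowAtT y T j (B + (r + k)) (lconv B (r + k) C' (gate (TPL[r, k, g]) q)) := by
    rw [e]; exact hF.smul μ⁻¹ hμi.le
  have AM : ∀ u, B + (r + k) < u → lconv B (r + k) C' (gate (TPL[r, k, g]) q) u = 0 := fun u hu => lconv_eq_zero B (r + k) _ _ u hu
  have A1 : ∑ u ∈ Finset.range (B + (r + k) + 1), lconv B (r + k) C' (gate (TPL[r, k, g]) q) u = 1 := sum_lconv B (r + k) _ _ c1 t1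
  have hdec := decAtT_of_flowAtT y T j (B + (r + k)) _ hy0 hy1 AM A1 hF'
  have h' := glued_image_dual_le y q g T r k j B C' α p hy0 hy1 hr hjM.le hdec hp hαp
  have e2 : ∑ i ∈ Finset.range (B + 1), C' i * gluedPullback T q g j r k α p i
      = μ⁻¹ * ∑ i ∈ Finset.range (B + 1), C i * gluedPullback T q g j r k α p i := by
    rw [Finset.mul_sum]; refine Finset.sum_congr rfl fun i _ => by rw [hC']; ring
  rw [e2] at h'
  by_contra hc
  have : 0 < μ⁻¹ * ∑ i ∈ Finset.range (B + 1), C i * gluedPullback T q g j r k α p i := mul_pos hμi (not_le.1 hc)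
  linarith

/-- **LEMMA W ⟹ THE LIGHT WINDOW PAIR CONDITION BELOW A CHEAP ATOM.**  In the band frame, for a price system `(α, p)` of the positions `{0..B+(r+k)}` at
`(y, T, j)`, a light window pair `(l, h)` (`l < h ≤ B`, `h ≤ j < h+r+k`, `2l < T₀ < l+h`, `γ = pairGate y T₀ l h < y`), a position `c` (`h ≤ c ≤ B`, `c ≤ j`)
CHEAP with respect to a low `l*` (`−Ψ(c)·y < (1−y)·Ψ(l*)`): `(1−γ)·Ψ(l) + γ·Ψ(h) ≤ 0`. [this work] -/
theorem gluedPullback_windowPair_of_lemmaW (hW : GluedLemmaW) (x a q g S : ℝ) (B r k j l h c ls : ℕ) (α p : ℕ → ℝ)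
    (hx0 : 0 < x) (hx1 : x < 1) (ha0 : 0 < a) (ha1 : a ≤ 1) (hq0 : 0 < q) (hq1 : q < 1) (hg0 : 0 ≤ g) (hg1 : g ≤ 1) (hr : 1 ≤ r) (hk : 1 ≤ k)
    (hxqg : x ≤ q * g) (hband1 : 2 * (r : ℝ) < q * ((r : ℝ) + k * g)) (hband2 : q * ((r : ℝ) + k * g) - r < (k : ℝ) * x)
    (hSB1 : x * (B : ℝ) ≤ S) (hSB2 : S ≤ (B : ℝ)) (hjM : j < B + (r + k))
    (hlh : l < h) (hhB : h ≤ B) (hhj : h ≤ j) (hwin : j < h + r + k) (hlow : 2 * (l : ℝ) < a * S) (hcomp : a * S < (l : ℝ) + h)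
    (hlight : pairGate (a * x) (a * S) l h < a * x)
    (hhc : h ≤ c) (hcB : c ≤ B) (hcj : c ≤ j) (hlsB : ls ≤ B) (hlsj : ls ≤ j) (hlsl : 2 * (ls : ℝ) < a * S)
    (hp : ∀ h, 0 ≤ p h)
    (hαp : ∀ l' h', l' ≤ j → 2 * (l' : ℝ) < a * (S + q * ((r : ℝ) + k * g)) → h' ≤ B + (r + k) →
      (j + 1 ≤ h' ∨ a * (S + q * ((r : ℝ) + k * g)) < (l' : ℝ) + h') →
      α l' ≤ usage (a * x) (a * (S + q * ((r : ℝ) + k * g))) j l' h' * p h')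
    (hcheap : -(gluedPullback (a * (S + q * ((r : ℝ) + k * g))) q g j r k α p c) * (a * x)
      < (1 - a * x) * gluedPullback (a * (S + q * ((r : ℝ) + k * g))) q g j r k α p ls) :
    (1 - pairGate (a * x) (a * S) l h) * gluedPullback (a * (S + q * ((r : ℝ) + k * g))) q g j r k α p l
      + pairGate (a * x) (a * S) l h * gluedPullback (a * (S + q * ((r : ℝ) + k * g))) q g j r k α p h ≤ 0 := by
  set y : ℝ := a * x with hy
  set T : ℝ := a * (S + q * ((r : ℝ) + k * g)) with hT
  set γ : ℝ := pairGate (a * x) (a * S) l h with hγ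
  set Ψ : ℕ → ℝ := gluedPullback T q g j r k α p with hΨ
  have hy0 : 0 < y := mul_pos ha0 hx0
  have hy1 : y < 1 := by rw [hy]; nlinarith
  obtain ⟨τ, hτ0, hF⟩ := hW x a q g S B r k j l h c ls hx0 hx1 ha0 ha1 hq0 hq1 hg0 hg1 hr hk hxqg hband1 hband2 hSB1 hSB2 hjM hlh hhB hhj
    hwin hlow hcomp hlight hhc hcB hcj hlsB hlsj hlsl
  have hγ0 : 0 < γ := pairGate_pos (a * x) (a * S) l h hlow hlh
  have hγ1 : γ < 1 := lt_trans hlight hy1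
  set u : ℝ := y / (1 - y) with hu
  have hu0 : 0 < u := div_pos hy0 (by linarith)
  have hCsum : ∑ i ∈ Finset.range (B + 1), (γ * δ[h] i + (1 - γ) * δ[l] i + τ * δ[ls] i + τ * u * δ[c] i) = 1 + τ + τ * u := by
    have := sum_W_gluedPullback B l h c ls γ τ u (fun _ => (1 : ℝ)) (by omega) hhB hcB hlsB
    simp only [mul_one] at this
    rw [this]; ring
  have hCpos : 0 < ∑ i ∈ Finset.range (B + 1), (γ * δ[h] i + (1 - γ) * δ[l] i + τ * δ[ls] i + τ * u * δ[c] i) := by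
    rw [hCsum]; nlinarith
  have hdual := glued_measure_dual_le y q g T r k j B _ α p hy0 hy1 hq0.le hq1.le hg0 hg1 hr hjM hCpos hF hp hαp
  rw [sum_W_gluedPullback B l h c ls γ τ u Ψ (by omega) hhB hcB hlsB] at hdual
  -- cheapness: τ·(Ψ(l*) + u·Ψ(c)) ≥ 0
  have hbr : 0 ≤ Ψ ls + u * Ψ c := by
    have h1y : 0 < 1 - y := by linarith
    have : 0 < (1 - y) * Ψ ls + Ψ c * y := by
      have := hcheap
      linarith
    have e : Ψ ls + u * Ψ c = ((1 - y) * Ψ ls + Ψ c * y) / (1 - y) := by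
      rw [hu]; field_simp
    rw [e]; positivity
  nlinarith [mul_nonneg hτ0 hbr]

/-- **LEMMA W ⟹ THE PAIR CONDITION IN USAGE FORM**: under the hypotheses of `gluedPullback_windowPair_of_lemmaW`, for every layer `J ≥ h` of the first factor,
`Ψ(l) ≤ usage y T₀ J l h · (−Ψ(h))`. [this work] -/
theorem gluedPullback_windowPair_usage_of_lemmaW (hW : GluedLemmaW) (x a q g S : ℝ) (B r k j l h c ls J : ℕ) (α p : ℕ → ℝ)
    (hx0 : 0 < x) (hx1 : x < 1) (ha0 : 0 < a) (ha1 : a ≤ 1) (hq0 : 0 < q) (hq1 : q < 1) (hg0 : 0 ≤ g) (hg1 : g ≤ 1) (hr : 1 ≤ r) (hk : 1 ≤ k)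
    (hxqg : x ≤ q * g) (hband1 : 2 * (r : ℝ) < q * ((r : ℝ) + k * g)) (hband2 : q * ((r : ℝ) + k * g) - r < (k : ℝ) * x)
    (hSB1 : x * (B : ℝ) ≤ S) (hSB2 : S ≤ (B : ℝ)) (hjM : j < B + (r + k))
    (hlh : l < h) (hhB : h ≤ B) (hhj : h ≤ j) (hwin : j < h + r + k) (hlow : 2 * (l : ℝ) < a * S) (hcomp : a * S < (l : ℝ) + h)
    (hlight : pairGate (a * x) (a * S) l h < a * x) (hhJ : h ≤ J)
    (hhc : h ≤ c) (hcB : c ≤ B) (hcj : c ≤ j) (hlsB : ls ≤ B) (hlsj : ls ≤ j) (hlsl : 2 * (ls : ℝ) < a * S)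
    (hp : ∀ h, 0 ≤ p h)
    (hαp : ∀ l' h', l' ≤ j → 2 * (l' : ℝ) < a * (S + q * ((r : ℝ) + k * g)) → h' ≤ B + (r + k) →
      (j + 1 ≤ h' ∨ a * (S + q * ((r : ℝ) + k * g)) < (l' : ℝ) + h') →
      α l' ≤ usage (a * x) (a * (S + q * ((r : ℝ) + k * g))) j l' h' * p h')
    (hcheap : -(gluedPullback (a * (S + q * ((r : ℝ) + k * g))) q g j r k α p c) * (a * x)
      < (1 - a * x) * gluedPullback (a * (S + q * ((r : ℝ) + k * g))) q g j r k α p ls) :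
    gluedPullback (a * (S + q * ((r : ℝ) + k * g))) q g j r k α p l
      ≤ usage (a * x) (a * S) J l h * (- gluedPullback (a * (S + q * ((r : ℝ) + k * g))) q g j r k α p h) := by
  have hpair := gluedPullback_windowPair_of_lemmaW hW x a q g S B r k j l h c ls α p hx0 hx1 ha0 ha1 hq0 hq1 hg0 hg1 hr hk hxqg hband1 hband2
    hSB1 hSB2 hjM hlh hhB hhj hwin hlow hcomp hlight hhc hcB hcj hlsB hlsj hlsl hp hαp hcheap
  have hy1 : a * x < 1 := by nlinarith
  have hγ1 : pairGate (a * x) (a * S) l h < 1 := lt_trans hlight hy1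
  have hu : usage (a * x) (a * S) J l h = pairGate (a * x) (a * S) l h / (1 - pairGate (a * x) (a * S) l h) := by
    have hnj : ¬ (J + 1 ≤ h) := by omega
    simp only [usage, gateOf, if_neg hnj]
  rw [hu]
  exact le_usage_of_pair_le _ _ _ hγ1 hpair

end LawDec
end Quant
end Summit.CriticalPhenomena.PercolationContinuityZ3.Theorems
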